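import Summits.BirchSwinnertonDyer.Rank1Residual.GaloisImage.WildThreeTorsionValuation
import HarnessLib

/-!
# Valuations of the `9`-torsion coordinates above a non-canonical `3`-torsion point on a WILD
# normal-shape equation at `3`: ONE Newton slope
# (cell `b2b-bsdres`, team n1011, seat p02 gen 3, OWNERS row T-b10 'wild tower at 3', file F1c)

HONEST FRAMING (cell `b2b-bsdres`, run/shared/lean/b2b/bsd-rank1-residual/, verbatim in every
file): the goal of the cell is to DELETE the COMBINATION-SHAPED residual classes of the
Birch–Swinnerton-Dyer formula for ALL analytic-rank `≤ 1` elliptic curves over `ℚ` — "full BSD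
formula for every rank `≤ 1` curve in class `C`" assembled STRICTLY from published theorems — so
that the rank-`≤ 1` remainder becomes exactly the CONSTRUCTION-SHAPED classes, which are TYPED
(missing-input `Prop`s), NOT attempted. This is not "finishing BSD". Team n1011 (N10 / N11, the
additive block X4 ∧ `p = 3`): research route on the CONSTRUCTION-SHAPED class X4; no claim beyond the
stated classes; nothing is booked. Theorems only (no definition, no named fact).

## What this file proves (`v` = the place over `3`, `t = v(3)`; normal shape
`a₁ = a₃ = a₆ = 0`, `a₄ = 1`, `v(a₂)⁶ = t^m`, `1 ≤ m ≤ 4`, see `WildShapeValuation`)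

* `eval_Φ_three_sub_mul_Ψ₃_sq_of_shape` — the coefficients of `Φ₃ − ξψ₃²` in normal shape:
  `c₈ = −9ξ`, `c₇ = −12 − 24a₂ξ`, …, `c₁ = 9`, `c₀ = −ξ` (from n1011-p14's
  `eval_Φ_three_sub_mul_Ψ₃_sq`, TREE).
* `valuation_pow_162_eq_of_mul_rel_wild` — if `ξ·ψ₃(x)² = Φ₃(x)` (`x` the abscissa of `Q` with
  `3Q = ±(ξ, ·)`) and `v(ξ)¹⁸·t^m = 1` (non-canonical, file `WildThreeTorsionValuation`), then
  **`v(x)¹⁶²·t^m = 1`** — all nine roots, ONE Newton slope: `v(c₀) = v(ξ)` and every other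
  coefficient is strictly above the segment with margin `162a + 27mb + mk > 9mc` for a monomial
  `3ᵃ·a₂ᵇ·ξᶜ` of `c_{9−k}`; the root is pinned by n1011-p14's `valuation_eq_of_monic_relation_nine`
  (TREE).
* `valuation_Y_pow_108_eq_wild` — the ordinate: `y² = x³ + a₂x² + x` with `x³` dominant gives
  **`v(y)¹⁰⁸·t^m = 1`** (valuation `−m/108`; denominator divisible by `27` exactly when `3 ∤ m`).

This is the input of the inertia criterion `GaloisImage/ThreeAdicTowerInertiaCriterion` (p02 gen 2);
the tower is assembled in `WildThreeAdicTower`.  `m = 3` (Elkies' `9`-deficient curves, every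
`v₃(N) = 5` row) and `m ≥ 5` give denominators `9·2ᵏ` only: nothing is claimed there.

References: J.-P. Serre, Invent. Math. 15 (1972) §1.9–1.11; Silverman *AEC* Ex. 3.7 (d);
N. Katz (1973) §3.10; N. Elkies, arXiv:math/0612734.
-/

noncomputable section

-- Exponents up to `162` occur on elements of the value group `(placeOver 3).ValueGroup` (a
-- quotient type on which numerals `x ^ 162` are unfolded by `whnf` during unification); the
-- default recursion depth (512) does not suffice for that unfolding.  Nothing else is affected.
set_option maxRecDepth 10000

open scoped Classical

open Polynomial WeierstrassCurve

namespace Summit.BirchSwinnertonDyer.Rank1Residual.GaloisImage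

open Literature.NumberTheory.EllipticCurves

variable (W : WeierstrassCurve (AlgebraicClosure ℚ))

/-! ### §3 The `9`-torsion abscissae above a non-canonical `3`-torsion point: ONE Newton slope -/

section Nine

variable {W}

/-- The coefficients of `Φ₃ − ξψ₃²` in normal shape (`b₂ = 4a₂`, `b₄ = 2`, `b₆ = 0`, `b₈ = −1`):
`c₈ = −9ξ`, `c₇ = −12 − 24a₂ξ`, `c₆ = −36ξ − 8a₂ − 16a₂²ξ`, `c₅ = 30 − 48a₂ξ`, `c₄ = −30ξ + 48a₂`,
`c₃ = 36 + 8a₂ξ + 16a₂²`, `c₂ = 12ξ + 24a₂`, `c₁ = 9`, `c₀ = −ξ`. [folklore] -/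
theorem eval_Φ_three_sub_mul_Ψ₃_sq_of_shape (h1 : W.a₁ = 0) (h3 : W.a₃ = 0) (h4 : W.a₄ = 1)
    (h6 : W.a₆ = 0) (x ξ : AlgebraicClosure ℚ) :
    (W.Φ 3).eval x - ξ * (W.Ψ₃.eval x) ^ 2 =
      x ^ 9 + ((-9 * ξ) * x ^ 8 + (-12 - 24 * W.a₂ * ξ) * x ^ 7 +
        (-36 * ξ - 8 * W.a₂ - 16 * W.a₂ ^ 2 * ξ) * x ^ 6 + (30 - 48 * W.a₂ * ξ) * x ^ 5 +
        (-30 * ξ + 48 * W.a₂) * x ^ 4 + (36 + 8 * W.a₂ * ξ + 16 * W.a₂ ^ 2) * x ^ 3 +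
        (12 * ξ + 24 * W.a₂) * x ^ 2 + 9 * x + -ξ) := by
  rw [eval_Φ_three_sub_mul_Ψ₃_sq, b₂_of_shape h1, b₄_of_shape h1 h3 h4, b₆_of_shape h3 h6,
    b₈_of_shape h1 h3 h4 h6]
  ring

/-- **§3. `v(x)¹⁶²·v(3)^m = 1` for the abscissa `x` of a point `Q` with `3Q = ±P`, `P = (ξ, _)` a
NON-CANONICAL point of order `3`** (`v(ξ)¹⁸·v(3)^m = 1`), in normal shape with `v(a₂)⁶ = v(3)^m`,
`1 ≤ m ≤ 4`, given the multiplication-by-`3` relation `ξ·ψ₃(x)² = Φ₃(x)`.  The Newton polygon of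
`Φ₃ − ξψ₃²` is ONE segment: `v(c₀) = v(ξ) = β⁹` and every other coefficient is STRICTLY above
(`c₁ = 9`; the margins are `162a + 27mb + mk > 9mc` for a monomial `3^a·a₂^b·ξ^c` in `c_{9−k}`),
so n1011-p14's `valuation_eq_of_monic_relation_nine` pins `v(x) = β`, `β^{162}·v(3)^m = 1`
(valuation `−m/162`: all nine roots, as in the formal group of the good supersingular model).
[folklore] -/
theorem valuation_pow_162_eq_of_mul_rel_wild (h1 : W.a₁ = 0) (h3 : W.a₃ = 0) (h4 : W.a₄ = 1)
    (h6 : W.a₆ = 0) {m : ℕ} (hm1 : 1 ≤ m) (hm4 : m ≤ 4)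
    (hα : (placeOver 3).valuation W.a₂ ^ 6 = (placeOver 3).valuation (3 : AlgebraicClosure ℚ) ^ m)
    {x ξ : AlgebraicClosure ℚ} (hrel : ξ * (W.Ψ₃.eval x) ^ 2 = (W.Φ 3).eval x)
    (hξ : (placeOver 3).valuation ξ ^ 18 * (placeOver 3).valuation (3 : AlgebraicClosure ℚ) ^ m = 1) :
    (placeOver 3).valuation x ^ 162 * (placeOver 3).valuation (3 : AlgebraicClosure ℚ) ^ m = 1 := by
  set v := (placeOver 3).valuation with hv
  set t := v (3 : AlgebraicClosure ℚ) with ht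
  have ht1 : t < 1 := valuation_three_lt_one
  have ht0 : t ≠ 0 := valuation_three_ne_zero
  set α := v W.a₂ with hαdef
  set s := v ξ with hs
  have hs0 : s ≠ 0 := by
    rintro h0; rw [h0, zero_pow (by norm_num), zero_mul] at hξ; exact zero_ne_one hξ
  -- a ninth root `β` of `s` in the value group: `β = v(λ)`, `λ⁹ = ξ`
  obtain ⟨lam, hlam⟩ := IsAlgClosed.exists_pow_nat_eq ξ (by norm_num : 0 < 9)
  set β := v lam with hβ
  have hβ9 : β ^ 9 = s := by rw [hβ, ← map_pow, hlam]
  have hβ0 : β ≠ 0 := by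
    intro h0; rw [h0, zero_pow (by norm_num)] at hβ9; exact hs0 hβ9.symm
  have hβ162 : β ^ 162 * t ^ m = 1 := by
    rw [show (162 : ℕ) = 9 * 18 by norm_num, pow_mul, hβ9, hξ]
  -- the generic margin: `v(X) ≤ t^a α^b s^c` with `9mc < 162a + 27mb + mk` gives `v(X) < β^k`
  have bnd : ∀ {X : AlgebraicClosure ℚ} {a b c k : ℕ}, v X ≤ t ^ a * α ^ b * s ^ c →
      9 * m * c < 162 * a + 27 * m * b + m * k → v X < β ^ k := by
    intro X a b c k hX hlt
    refine lt_of_pow_lt_pow_left₀ 162 zero_le ?_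
    set T := t ^ (9 * m * c + m * k) with hT
    have hT0 : T ≠ 0 := pow_ne_zero _ ht0
    have hR : (β ^ k) ^ 162 * T = t ^ (9 * m * c) := by
      have e1 : (β ^ k) ^ 162 = s ^ (18 * k) := by
        rw [← pow_mul, show k * 162 = 9 * (18 * k) by ring, pow_mul, hβ9]
      have e2 : s ^ (18 * k) * t ^ (m * k) = 1 := by
        rw [pow_mul s 18 k, pow_mul t m k, ← mul_pow, hξ, one_pow]
      rw [e1, hT, pow_add, mul_comm (t ^ (9 * m * c)), ← mul_assoc, e2, one_mul]
    have hL : (t ^ a * α ^ b * s ^ c) ^ 162 * T = t ^ (162 * a + 27 * m * b + m * k) := by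
      have e1 : (α ^ b) ^ 162 = t ^ (27 * m * b) := by
        rw [← pow_mul, show b * 162 = 6 * (27 * b) by ring, pow_mul α 6 (27 * b), hα, ← pow_mul,
          show m * (27 * b) = 27 * m * b by ring]
      have e2 : (s ^ c) ^ 162 * t ^ (9 * m * c) = 1 := by
        rw [← pow_mul, show c * 162 = 18 * (9 * c) by ring, show 9 * m * c = m * (9 * c) by ring,
          pow_mul s 18 (9 * c), pow_mul t m (9 * c), ← mul_pow, hξ, one_pow]
      rw [mul_pow, mul_pow, e1, hT, pow_add, ← pow_mul]
      calc t ^ (a * 162) * t ^ (27 * m * b) * (s ^ c) ^ 162 * (t ^ (9 * m * c) * t ^ (m * k))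
          = t ^ (a * 162) * t ^ (27 * m * b) * t ^ (m * k) * ((s ^ c) ^ 162 * t ^ (9 * m * c)) := by
            ac_rfl
        _ = t ^ (162 * a + 27 * m * b + m * k) := by
            rw [e2, mul_one, ← pow_add, ← pow_add]; congr 1; ring
    have key : v X ^ 162 * T < (β ^ k) ^ 162 * T := by
      calc v X ^ 162 * T ≤ (t ^ a * α ^ b * s ^ c) ^ 162 * T :=
            mul_le_mul' (pow_le_pow_left₀ zero_le hX 162) le_rfl
        _ = t ^ (162 * a + 27 * m * b + m * k) := hL
        _ < t ^ (9 * m * c) := (pow_lt_pow_iff_of_lt_one' ht0 ht1).mpr hlt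
        _ = (β ^ k) ^ 162 * T := hR.symm
    exact lt_of_mul_lt_mul_right' key
  -- atoms
  have hle1 : ∀ n : ℕ, v (n : AlgebraicClosure ℚ) ≤ 1 := fun n ↦
    ((placeOver 3).valuation_le_one_iff _).mpr (natCast_mem (placeOver 3) n)
  have hN0 : ∀ n : ℕ, v (n : AlgebraicClosure ℚ) ≤ t ^ 0 * α ^ 0 * s ^ 0 := fun n ↦ by
    simpa using hle1 n
  have hN1 : ∀ n : ℕ, v ((3 * n : ℕ) : AlgebraicClosure ℚ) ≤ t ^ 1 * α ^ 0 * s ^ 0 := fun n ↦ by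
    rw [Nat.cast_mul, map_mul, pow_one, pow_zero, pow_zero, mul_one, mul_one, Nat.cast_ofNat]
    calc v 3 * v (n : AlgebraicClosure ℚ) ≤ t * 1 := mul_le_mul' le_rfl (hle1 n)
      _ = t := mul_one _
  have hN2 : ∀ n : ℕ, v ((9 * n : ℕ) : AlgebraicClosure ℚ) ≤ t ^ 2 * α ^ 0 * s ^ 0 := fun n ↦ by
    rw [Nat.cast_mul, map_mul, pow_zero, pow_zero, mul_one, mul_one,
      show ((9 : ℕ) : AlgebraicClosure ℚ) = 3 ^ 2 by norm_num, map_pow]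
    calc t ^ 2 * v (n : AlgebraicClosure ℚ) ≤ t ^ 2 * 1 := mul_le_mul' le_rfl (hle1 n)
      _ = t ^ 2 := mul_one _
  have h9 : v (9 : AlgebraicClosure ℚ) ≤ t ^ 2 * α ^ 0 * s ^ 0 := by simpa using hN2 1
  have h36 : v (36 : AlgebraicClosure ℚ) ≤ t ^ 2 * α ^ 0 * s ^ 0 := by simpa using hN2 4
  have h12 : v (12 : AlgebraicClosure ℚ) ≤ t ^ 1 * α ^ 0 * s ^ 0 := by simpa using hN1 4
  have h24 : v (24 : AlgebraicClosure ℚ) ≤ t ^ 1 * α ^ 0 * s ^ 0 := by simpa using hN1 8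
  have h30 : v (30 : AlgebraicClosure ℚ) ≤ t ^ 1 * α ^ 0 * s ^ 0 := by simpa using hN1 10
  have h48 : v (48 : AlgebraicClosure ℚ) ≤ t ^ 1 * α ^ 0 * s ^ 0 := by simpa using hN1 16
  have h8 : v (8 : AlgebraicClosure ℚ) ≤ t ^ 0 * α ^ 0 * s ^ 0 := by simpa using hN0 8
  have h16 : v (16 : AlgebraicClosure ℚ) ≤ t ^ 0 * α ^ 0 * s ^ 0 := by simpa using hN0 16
  have ha : v W.a₂ ≤ t ^ 0 * α ^ 1 * s ^ 0 := by simp [hαdef]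
  have hx' : v ξ ≤ t ^ 0 * α ^ 0 * s ^ 1 := by simp [hs]
  -- monomial calculus
  have hmul : ∀ {X Y : AlgebraicClosure ℚ} {a b c a' b' c' : ℕ}, v X ≤ t ^ a * α ^ b * s ^ c →
      v Y ≤ t ^ a' * α ^ b' * s ^ c' →
      v (X * Y) ≤ t ^ (a + a') * α ^ (b + b') * s ^ (c + c') := by
    intro X Y a b c a' b' c' hX hY
    rw [map_mul]
    calc v X * v Y ≤ (t ^ a * α ^ b * s ^ c) * (t ^ a' * α ^ b' * s ^ c') := mul_le_mul' hX hY
      _ = t ^ (a + a') * α ^ (b + b') * s ^ (c + c') := by rw [pow_add, pow_add, pow_add]; ac_rfl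
  have hng : ∀ {X : AlgebraicClosure ℚ} {a b c : ℕ}, v X ≤ t ^ a * α ^ b * s ^ c →
      v (-X) ≤ t ^ a * α ^ b * s ^ c := by
    intro X a b c hX; rwa [Valuation.map_neg]
  have hsq : ∀ {X : AlgebraicClosure ℚ} {a b c : ℕ}, v X ≤ t ^ a * α ^ b * s ^ c →
      v (X ^ 2) ≤ t ^ (a + a) * α ^ (b + b) * s ^ (c + c) := by
    intro X a b c hX; rw [pow_two]; exact hmul hX hX
  -- coefficient bounds (margins `9mc < 162a + 27mb + mk`, all by `omega` from `1 ≤ m ≤ 4`)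
  have hc8 : v (-9 * ξ) < β ^ 1 := bnd (hmul (hng h9) hx') (by omega)
  have hc7 : v (-12 - 24 * W.a₂ * ξ) < β ^ 2 :=
    Valuation.map_sub_lt _ (bnd (hng h12) (by omega)) (bnd (hmul (hmul h24 ha) hx') (by omega))
  have hc6 : v (-36 * ξ - 8 * W.a₂ - 16 * W.a₂ ^ 2 * ξ) < β ^ 3 :=
    Valuation.map_sub_lt _ (Valuation.map_sub_lt _ (bnd (hmul (hng h36) hx') (by omega))
      (bnd (hmul h8 ha) (by omega))) (bnd (hmul (hmul h16 (hsq ha)) hx') (by omega))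
  have hc5 : v (30 - 48 * W.a₂ * ξ) < β ^ 4 :=
    Valuation.map_sub_lt _ (bnd h30 (by omega)) (bnd (hmul (hmul h48 ha) hx') (by omega))
  have hc4 : v (-30 * ξ + 48 * W.a₂) < β ^ 5 :=
    Valuation.map_add_lt _ (bnd (hmul (hng h30) hx') (by omega)) (bnd (hmul h48 ha) (by omega))
  have hc3 : v (36 + 8 * W.a₂ * ξ + 16 * W.a₂ ^ 2) < β ^ 6 :=
    Valuation.map_add_lt _ (Valuation.map_add_lt _ (bnd h36 (by omega))
      (bnd (hmul (hmul h8 ha) hx') (by omega))) (bnd (hmul h16 (hsq ha)) (by omega))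
  have hc2 : v (12 * ξ + 24 * W.a₂) < β ^ 7 :=
    Valuation.map_add_lt _ (bnd (hmul h12 hx') (by omega)) (bnd (hmul h24 ha) (by omega))
  have hc1 : v (9 : AlgebraicClosure ℚ) < β ^ 8 := bnd h9 (by omega)
  have hc0 : v (-ξ) = β ^ 9 := by rw [Valuation.map_neg, hβ9]
  -- assemble
  have hzero : x ^ 9 + ((-9 * ξ) * x ^ 8 + (-12 - 24 * W.a₂ * ξ) * x ^ 7 +
      (-36 * ξ - 8 * W.a₂ - 16 * W.a₂ ^ 2 * ξ) * x ^ 6 + (30 - 48 * W.a₂ * ξ) * x ^ 5 +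
      (-30 * ξ + 48 * W.a₂) * x ^ 4 + (36 + 8 * W.a₂ * ξ + 16 * W.a₂ ^ 2) * x ^ 3 +
      (12 * ξ + 24 * W.a₂) * x ^ 2 + 9 * x + -ξ) = 0 := by
    rw [← eval_Φ_three_sub_mul_Ψ₃_sq_of_shape h1 h3 h4 h6, ← hrel]; ring
  have hres := valuation_eq_of_monic_relation_nine v hβ0 hc0 hc1 hc2 hc3 hc4 hc5 hc6 hc7 hc8 hzero
  rw [hres, hβ162]

/-- **§3. The ordinate: `v(y)¹⁰⁸·v(3)^m = 1`** for a point `(x, y)` of the normal-shape equation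
(`y² = x³ + a₂x² + x`) whose abscissa has `v(x)¹⁶²·v(3)^m = 1` — the term `x³` dominates
(`v(a₂) < 1 < v(x)`).  Valuation `−m/108`: denominator divisible by `27` exactly when `3 ∤ m`.
[folklore] -/
theorem valuation_Y_pow_108_eq_wild (h1 : W.a₁ = 0) (h3 : W.a₃ = 0) (h4 : W.a₄ = 1)
    (h6 : W.a₆ = 0) {m : ℕ} (hm1 : 1 ≤ m)
    (hα : (placeOver 3).valuation W.a₂ ^ 6 = (placeOver 3).valuation (3 : AlgebraicClosure ℚ) ^ m)
    {x y : AlgebraicClosure ℚ} (hxy : W.toAffine.Equation x y)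
    (hx : (placeOver 3).valuation x ^ 162 * (placeOver 3).valuation (3 : AlgebraicClosure ℚ) ^ m = 1) :
    (placeOver 3).valuation y ^ 108 * (placeOver 3).valuation (3 : AlgebraicClosure ℚ) ^ m = 1 := by
  set v := (placeOver 3).valuation with hv
  set t := v (3 : AlgebraicClosure ℚ) with ht
  have ht1 : t < 1 := valuation_three_lt_one
  have ht0 : t ≠ 0 := valuation_three_ne_zero
  set α := v W.a₂ with hαdef
  set β := v x with hβ
  have htm1 : t ^ m < 1 := pow_lt_one₀ zero_le ht1 (by omega)
  have hα1 : α < 1 := by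
    by_contra hle; rw [not_lt] at hle
    have : 1 ≤ α ^ 6 := one_le_pow₀ hle
    rw [hα] at this
    exact absurd (this.trans_lt htm1) (lt_irrefl _)
  have hβ1 : 1 < β := by
    by_contra hle; rw [not_lt] at hle
    have h1' : β ^ 162 * t ^ m ≤ 1 * t ^ m := mul_le_mul' (pow_le_one₀ zero_le hle) le_rfl
    rw [hx, one_mul] at h1'
    exact absurd (h1'.trans_lt htm1) (lt_irrefl _)
  have hβ0 : β ≠ 0 := ne_of_gt (lt_trans zero_lt_one hβ1)
  -- the equation `y² = x³ + a₂x² + x`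
  have heq : y ^ 2 = x ^ 3 + W.a₂ * x ^ 2 + x := by
    have := (Affine.equation_iff ..).mp hxy
    rw [h1, h3, h4, h6] at this
    linear_combination this
  -- `x³` dominates
  have hd2 : v (W.a₂ * x ^ 2) < v (x ^ 3) := by
    rw [map_mul, map_pow, map_pow]
    calc α * β ^ 2 < 1 * β ^ 2 := mul_lt_mul_right_of_ne_zero' (pow_ne_zero _ hβ0) hα1
      _ < β * β ^ 2 := mul_lt_mul_right_of_ne_zero' (pow_ne_zero _ hβ0) hβ1
      _ = β ^ 3 := by rw [← pow_succ']
  have hd1 : v x < v (x ^ 3 + W.a₂ * x ^ 2) := by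
    rw [Valuation.map_add_eq_of_lt_left _ hd2, map_pow]
    calc β = β * 1 := (mul_one _).symm
      _ < β * β ^ 2 := mul_lt_mul_left_of_ne_zero hβ0 (one_lt_pow₀ hβ1 two_ne_zero)
      _ = β ^ 3 := by rw [← pow_succ']
  have hvy2 : v y ^ 2 = β ^ 3 := by
    rw [← map_pow, heq, Valuation.map_add_eq_of_lt_left _ hd1, Valuation.map_add_eq_of_lt_left _ hd2,
      map_pow]
  calc v y ^ 108 * t ^ m = (v y ^ 2) ^ 54 * t ^ m := by rw [← pow_mul]
    _ = β ^ 162 * t ^ m := by rw [hvy2, ← pow_mul]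
    _ = 1 := hx

end Nine

end Summit.BirchSwinnertonDyer.Rank1Residual.GaloisImage

end
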